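import Literature.AlgebraicGeometry.Resolution.FrobeniusNormIdeal
import Mathlib.RingTheory.Ideal.Operations
import HarnessLib

/-!
# Frobenius norms are compatible with localisation

Topic: `Literature/AlgebraicGeometry/Resolution`. The patching input "this follows from the
definition of `[[M]]`" of O. Villamayor U., J. Algebra 295 (2006), 3.4, for the norm of the
Frobenius push-forward (`FrobeniusNormIdeal.lean`): for a ring map `A → A'` under the field
`K ⊇ A, A'` (`IsScalarTower A A' K`) and a `K^q`-basis `β` of `K`,

* `frobeniusNormSet_subset`, `span_frobeniusNormSet_le` — `[[F^e_* A]]_β · A' ⊆ [[F^e_* A']]_β`;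
* `frobeniusNorm_eq_span_of_cover` — **equality `[[F^e_* A']]_β = [[F^e_* A]]_β · A'`** as soon
  as `A'` is covered by localisations of `A`: there is a set `S ⊆ A` whose image generates the
  unit ideal of `A'` such that every `a' ∈ A'` satisfies `s^k a' ∈ A` for each `s ∈ S` and some
  `k` (e.g. `A' = A[1/f]`, `S = {f}`; or `A = Γ(X, V) → A' = Γ(X, U)` for affine opens `U ⊆ V`
  of an integral scheme, `S` = the `f ∈ Γ(X, V)` with `D(f) ⊆ U`). Proof: for `d^q = det_β(m')`,
  `m' ∈ A'^r`, and `s ∈ S` with `s^k m'ᵢ ∈ A`, the tuple `cᵢ = s^{k(q-1)} · s^k m'ᵢ ∈ A` has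
  `det_β(c) = (s^{kr})^q det_β(m')` because `(s^k)^q ∈ K^q` is a scalar, so `s^{kr} d` lies in
  the norm set of `A`; the powers `s^{kr}`, `s ∈ S`, still generate the unit ideal.
* `frobeniusNorm_eq_span_of_isLocalization_away` — the case `A' = A[1/f]`.
* `IsFrobeniusNormIdeal.map_of_cover` / `.map_of_isLocalization_away` — **the extension
  `I · A'` of a Frobenius norm ideal of `A` is a Frobenius norm ideal of `A'`**.

All PROVED. [cite: Villamayoru2006, 3.4]

## Sources

* O. Villamayor U., *On flattening of coherent sheaves and of projective morphisms*,
  J. Algebra 295 (2006) 119–140, §2 and 3.4. [Villamayoru2006]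
-/

noncomputable section

open Module

namespace Literature.AlgebraicGeometry.Resolution

universe u v

variable {K : Type u} [Field K] {p : ℕ} [ExpChar K p] {e : ℕ}
variable {ι : Type v} [Fintype ι] [DecidableEq ι]
variable (β : Basis ι (iterateFrobeniusRange K p e) K)
variable (A A' : Type*) [CommRing A] [CommRing A'] [Algebra A K] [Algebra A' K] [Algebra A A']
  [IsScalarTower A A' K]

/-- Along `A → A' → K` the Frobenius norm set of `A` lies in that of `A'`. [folklore] -/
theorem frobeniusNormSet_subset : frobeniusNormSet β A ⊆ frobeniusNormSet β A' := by
  rintro d ⟨m, hm⟩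
  refine ⟨fun i => algebraMap A A' (m i), ?_⟩
  rw [hm]
  congr 2
  funext i
  exact IsScalarTower.algebraMap_apply A A' K (m i)

/-- Along `A → A' → K`, `[[F^e_* A]]_β · A' ⊆ [[F^e_* A']]_β`. [folklore] -/
theorem span_frobeniusNormSet_le :
    Submodule.span A' (frobeniusNormSet β A) ≤ frobeniusNorm β A' :=
  Submodule.span_mono (frobeniusNormSet_subset β A A')

variable {A A'}

/-- **Localisation compatibility of the Frobenius norm** (Villamayor 3.4: the morphisms patch
"from the definition of `[[M]]`"): if the image of `S ⊆ A` generates the unit ideal of `A'` and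
`A'` lies in `A[1/s]` for each `s ∈ S` (every `a' ∈ A'` has `s^k a' ∈ A`), then
`[[F^e_* A']]_β = [[F^e_* A]]_β · A'`. [cite: Villamayoru2006, 3.4] -/
theorem frobeniusNorm_eq_span_of_cover (S : Set A)
    (hS : Ideal.span (algebraMap A A' '' S) = ⊤)
    (hloc : ∀ s ∈ S, ∀ a' : A', ∃ (k : ℕ) (a : A),
      algebraMap A A' a = algebraMap A A' s ^ k * a') :
    frobeniusNorm β A' = Submodule.span A' (frobeniusNormSet β A) := by
  refine le_antisymm ?_ (span_frobeniusNormSet_le β A A')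
  rw [frobeniusNorm, Submodule.span_le]
  rintro d ⟨m', hm'⟩
  apply Submodule.mem_of_span_eq_top_of_smul_pow_mem _ _ hS
  rintro ⟨_, s, hs, rfl⟩
  -- a common exponent `k` with `s^k m'ᵢ ∈ A`
  choose k a hka using fun i => hloc s hs (m' i)
  let kk : ℕ := ∑ i, k i
  have hki : ∀ i, k i ≤ kk := fun i => Finset.single_le_sum (fun j _ => Nat.zero_le (k j))
    (Finset.mem_univ i)
  let s' : A' := algebraMap A A' s
  let σ : K := algebraMap A' K s'
  -- the tuple `cᵢ = s^{kk(q-1)} s^{kk-kᵢ} aᵢ ∈ A`, with `cᵢ = (s^kk)^q m'ᵢ` in `A'`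
  let c : ι → A := fun i => s ^ (kk * (p ^ e - 1)) * (s ^ (kk - k i) * a i)
  have hc : ∀ i, algebraMap A A' (c i) = s' ^ (kk * p ^ e) * m' i := by
    intro i
    obtain ⟨m₀, hm₀⟩ : ∃ m₀ : ℕ, p ^ e = m₀ + 1 :=
      ⟨p ^ e - 1, (Nat.sub_add_cancel (Nat.one_le_pow _ _ (expChar_pos K p))).symm⟩
    obtain ⟨d₀, hd₀⟩ : ∃ d₀ : ℕ, kk = k i + d₀ := ⟨kk - k i, (Nat.add_sub_cancel' (hki i)).symm⟩
    simp only [c, map_mul, map_pow, hka i]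
    rw [hd₀, Nat.add_sub_cancel_left, hm₀, Nat.add_sub_cancel]
    ring
  have hcK : (fun i => algebraMap A K (c i)) = fun i =>
      (⟨(σ ^ kk) ^ p ^ e, pow_mem_iterateFrobeniusRange _⟩ : iterateFrobeniusRange K p e) •
        algebraMap A' K (m' i) := by
    funext i
    rw [IsScalarTower.algebraMap_apply A A' K, hc i, map_mul, map_pow, Algebra.smul_def,
      Subfield.algebraMap_ofSubfield, pow_mul]
    rfl
  -- `det_β(c) = ((σ^kk)^q)^r det_β(m')`, so `σ^{kk r} d` is in the norm set of `A`
  have hdet : ((β.det fun i => algebraMap A K (c i) : iterateFrobeniusRange K p e) : K) =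
      (σ ^ (kk * Fintype.card ι)) ^ p ^ e *
        ((β.det fun i => algebraMap A' K (m' i) : iterateFrobeniusRange K p e) : K) := by
    rw [hcK]
    have := (β.det : MultilinearMap (iterateFrobeniusRange K p e) (fun _ : ι => K)
      (iterateFrobeniusRange K p e)).map_smul_univ
      (fun _ => (⟨(σ ^ kk) ^ p ^ e, pow_mem_iterateFrobeniusRange _⟩ : iterateFrobeniusRange K p e))
      (fun i => algebraMap A' K (m' i))
    rw [AlternatingMap.coe_multilinearMap] at this
    rw [this, Finset.prod_const, Finset.card_univ, smul_eq_mul, Subfield.coe_mul,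
      SubmonoidClass.coe_pow]
    congr 1
    change ((σ ^ kk) ^ p ^ e) ^ Fintype.card ι = (σ ^ (kk * Fintype.card ι)) ^ p ^ e
    ring
  refine ⟨kk * Fintype.card ι, Submodule.subset_span ⟨c, ?_⟩⟩
  rw [Algebra.smul_def, map_pow, mul_pow, ← pow_mul, hm', hdet, ← pow_mul]

/-- The case of one localisation `A' = A[1/f]`: `[[F^e_* A[1/f]]]_β = [[F^e_* A]]_β · A[1/f]`.
[cite: Villamayoru2006, 3.4] -/
theorem frobeniusNorm_eq_span_of_isLocalization_away (f : A) [IsLocalization.Away f A'] :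
    frobeniusNorm β A' = Submodule.span A' (frobeniusNormSet β A) := by
  refine frobeniusNorm_eq_span_of_cover β {f} ?_ ?_
  · rw [Set.image_singleton, Ideal.span_singleton_eq_top]
    exact IsLocalization.Away.algebraMap_isUnit f
  · rintro s rfl a'
    obtain ⟨⟨a, ⟨_, k, rfl⟩⟩, h⟩ := IsLocalization.surj (Submonoid.powers s) a'
    exact ⟨k, a, by rw [← h, map_pow, mul_comm]⟩

/-- The image in `K` of the extended ideal `I · A'` is the `A'`-span of the image of `I`.
[folklore] -/
theorem coeSubmodule_map_algebraMap (I : Ideal A) :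
    IsLocalization.coeSubmodule K (I.map (algebraMap A A')) =
      Submodule.span A' (IsLocalization.coeSubmodule K I : Set K) := by
  rw [IsLocalization.coeSubmodule, IsLocalization.coeSubmodule, Ideal.map, Ideal.span,
    Submodule.map_span, Submodule.map_coe, ← Set.image_comp]
  congr 1
  ext x
  constructor
  · rintro ⟨i, hi, rfl⟩
    refine ⟨i, hi, ?_⟩
    change algebraMap A K i = algebraMap A' K (algebraMap A A' i)
    exact IsScalarTower.algebraMap_apply A A' K i
  · rintro ⟨i, hi, rfl⟩
    refine ⟨i, hi, ?_⟩
    change algebraMap A' K (algebraMap A A' i) = algebraMap A K i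
    exact (IsScalarTower.algebraMap_apply A A' K i).symm

/-- **Extensions of Frobenius norm ideals along covered localisations are Frobenius norm
ideals**: under the hypotheses of `frobeniusNorm_eq_span_of_cover`, if `I ⊆ A` is a Frobenius
norm ideal then so is `I · A' ⊆ A'`. [cite: Villamayoru2006, 3.4] -/
theorem IsFrobeniusNormIdeal.map_of_cover {I : Ideal A} (hI : IsFrobeniusNormIdeal K p e I)
    (S : Set A) (hS : Ideal.span (algebraMap A A' '' S) = ⊤)
    (hloc : ∀ s ∈ S, ∀ a' : A', ∃ (k : ℕ) (a : A),
      algebraMap A A' a = algebraMap A A' s ^ k * a') :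
    IsFrobeniusNormIdeal K p e (I.map (algebraMap A A')) := by
  obtain ⟨ι, _, _, β, hβ⟩ := hI
  refine ⟨ι, inferInstance, inferInstance, β, ?_⟩
  rw [coeSubmodule_map_algebraMap, hβ, frobeniusNorm_eq_span_of_cover (A := A) (A' := A') β S hS
    hloc, frobeniusNorm, Submodule.span_span_of_tower]

/-- **The extension of a Frobenius norm ideal to a localisation `A[1/f]` is a Frobenius norm
ideal.** [cite: Villamayoru2006, 3.4] -/
theorem IsFrobeniusNormIdeal.map_of_isLocalization_away {I : Ideal A}
    (hI : IsFrobeniusNormIdeal K p e I) (f : A) [IsLocalization.Away f A'] :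
    IsFrobeniusNormIdeal K p e (I.map (algebraMap A A')) := by
  obtain ⟨ι, _, _, β, hβ⟩ := hI
  refine ⟨ι, inferInstance, inferInstance, β, ?_⟩
  rw [coeSubmodule_map_algebraMap, hβ,
    frobeniusNorm_eq_span_of_isLocalization_away (A := A) (A' := A') β f, frobeniusNorm,
    Submodule.span_span_of_tower]

end Literature.AlgebraicGeometry.Resolution

end
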